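import Mathlib
import HarnessLib

/-!
# O'Donnell–Saks–Schramm–Servedio (2005): the two-function (covariance) OSSS inequality
# for deterministic decision trees — statement AND proof

CITATION HEADER. Source: R. O'Donnell, M. Saks, O. Schramm, R. A. Servedio, *Every decision tree
has an influential variable*, Proc. 46th IEEE FOCS (2005), 31–39, arXiv:cs/0508071; textbook form:
R. O'Donnell, *Analysis of Boolean Functions*, Cambridge Univ. Press 2014, §8.6 ("OSSS inequality").
What is reproduced: the covariance ("two-function") form of the inequality, fully proved here (no
named facts, no hypotheses imported): for a reduced deterministic adaptive decision tree `T` on the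
cube `Fin n → Bool` with real leaf labels of absolute value `≤ 1` and ANY `g : (Fin n → Bool) → ℝ`,

  `Cov[T.eval, g] ≤ ∑ j, δ_j(T) · E|D_j g|`,  `δ_j(T) = Pr[T queries j]`,
  `D_j g (x) = (g(x^{j→1}) − g(x^{j→0}))/2`                       (`DTree.osss_cov`),

hence `Cov[T.eval, g] ≤ depth(T) · max_j E|D_j g|` (`DTree.osss_cov_depth`).  The one-function
OSSS inequality `Var f ≤ ∑_j δ_j(T) Inf_j(f)` of the title is the case `g = f` Boolean.  Everything is
stated with finite sums over the cube (uniform measure = normalised counting); no measure theory.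
Origin: solo seat `solo-QuantumAdvantage-informed` (summit QuantumAdvantage), session 16, where the
covariance form is the step "`L²`-approximating decision trees of depth `D` force a variable of
influence `≥ Var²/(4D²)`" in the equivalence between `poly(d, 1/ε, 1/δ)` classical simulation of
bounded degree-`d` polynomials and the Aaronson–Ambainis conjecture (the seat's PROPOSITION C);
Mathlib has no decision-tree / OSSS material at the time of writing (cf. the remark in
`Literature.Probability.Percolation.ClusterExploration`).

PROOF ROUTE. The inductive form of the OSSS hybrid argument: the hybrid input `T.hybrid x y` agrees
with the independent input `x` on the variables `T` queries along the path of `y` and with `y`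
elsewhere; injecting FRESH bits on the queried coordinates is what makes every intermediate hybrid
exactly uniform, and the induction on `T` goes through the coordinate-swap involution
`(x, y) ↦ (x^{i→y_i}, y^{i→x_i})` (`sum_sum_swap`).  Two inductive statements: the HYBRID BOUND
`E_{x,y}|g(y) − g(T.hybrid x y)| ≤ ∑_j δ_j(T) E|D_j g|` (`DTree.hybrid_bound`) and the LEAF STEP
`E_{x,y}[T.eval y · g(T.hybrid x y)] = E[T.eval]·E[g]` (`DTree.sum_eval_mul_hybrid`); the covariance
bound is their combination.  (The naive induction with restricted influences proves neither.)
"Reduced" (a queried variable does not occur below the node querying it) is the without-loss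
normal form of deterministic trees; `qprob` is defined by the recursion the query probabilities of a
reduced tree satisfy, and `∑_j qprob_j ≤ depth` (`DTree.sum_qprob_le_depth`).
-/

namespace Literature.Probability.ODonnellSaksSchrammServedio2005

open Finset Function

variable {n : ℕ}

/-- Points of the Boolean cube `{0,1}ⁿ`. [folklore] -/
abbrev Cube (n : ℕ) := Fin n → Bool

/-- Deterministic adaptive decision trees with real leaf labels: `node i t₀ t₁` queries
coordinate `i` and continues with `t₁` if it is `true`, with `t₀` otherwise. [folklore] -/
inductive DTree (n : ℕ) : Type
  | leaf : ℝ → DTree n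
  | node : Fin n → DTree n → DTree n → DTree n

namespace DTree

/-- Output of the tree on input `x`. [folklore] -/
def eval : DTree n → Cube n → ℝ
  | leaf v, _ => v
  | node i t₀ t₁, x => if x i then t₁.eval x else t₀.eval x

/-- The variables occurring anywhere in the tree. [folklore] -/
def vars : DTree n → Finset (Fin n)
  | leaf _ => ∅
  | node i t₀ t₁ => insert i (t₀.vars ∪ t₁.vars)

/-- Depth (longest root-to-leaf path). [folklore] -/
def depth : DTree n → ℕ
  | leaf _ => 0
  | node _ t₀ t₁ => max t₀.depth t₁.depth + 1

/-- Reduced trees: a queried variable does not occur again below the node querying it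
(every deterministic tree is equivalent to a reduced one of no larger depth). [folklore] -/
def Reduced : DTree n → Prop
  | leaf _ => True
  | node i t₀ t₁ => i ∉ t₀.vars ∧ i ∉ t₁.vars ∧ t₀.Reduced ∧ t₁.Reduced

/-- Query weights `δ_j(T)`: for a reduced tree, the probability over a uniform input that `T`
queries `j` (defined by the recursion it satisfies). [cite: OdonnellEtAl2005, §1 definition of δ_i p. 3] -/
noncomputable def qprob : DTree n → Fin n → ℝ
  | leaf _, _ => 0
  | node i t₀ t₁, j => (if j = i then 1 else 0) + (t₀.qprob j + t₁.qprob j) / 2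

/-- The OSSS hybrid input: agrees with `x` on the variables `T` queries along the path of `y`,
and with `y` elsewhere (the strings `u[t]` of the OSSS proof, with fresh bits injected on the queried
coordinates). [cite: OdonnellEtAl2005, proof of Thm 3.1 p. 7] -/
def hybrid : DTree n → Cube n → Cube n → Cube n
  | leaf _, _, y => y
  | node i t₀ t₁, x, y =>
      if y i then t₁.hybrid x (update y i (x i)) else t₀.hybrid x (update y i (x i))

/-- Query weights are nonnegative. [folklore] -/
theorem qprob_nonneg (T : DTree n) (j : Fin n) : 0 ≤ T.qprob j := by
  induction T with
  | leaf v => simp [qprob]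
  | node i t₀ t₁ ih₀ ih₁ =>
    simp only [qprob]
    split_ifs <;> linarith

/-- `∑_j δ_j(T) ≤ depth(T)` (the expected number of queries is at most the depth). [folklore] -/
theorem sum_qprob_le_depth (T : DTree n) : ∑ j, T.qprob j ≤ (T.depth : ℝ) := by
  induction T with
  | leaf v => simp [qprob, depth]
  | node i t₀ t₁ ih₀ ih₁ =>
    have h : ∑ j, (node i t₀ t₁).qprob j = 1 + ((∑ j, t₀.qprob j) + ∑ j, t₁.qprob j) / 2 := by
      simp only [qprob, Finset.sum_add_distrib, Finset.sum_ite_eq', Finset.mem_univ, if_true,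
        ← Finset.sum_div]
    have hd : ((node i t₀ t₁).depth : ℝ) = max (t₀.depth : ℝ) (t₁.depth : ℝ) + 1 := by
      simp only [depth, Nat.cast_add, Nat.cast_max, Nat.cast_one]
    rw [h, hd]
    have h0 : (t₀.depth : ℝ) ≤ max (t₀.depth : ℝ) (t₁.depth : ℝ) := le_max_left _ _
    have h1 : (t₁.depth : ℝ) ≤ max (t₀.depth : ℝ) (t₁.depth : ℝ) := le_max_right _ _
    linarith

/-- A subtree not containing `i` does not read coordinate `i`. [folklore] -/
theorem eval_update_of_not_mem {T : DTree n} {i : Fin n} (h : i ∉ T.vars) (x : Cube n) (c : Bool) :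
    T.eval (update x i c) = T.eval x := by
  induction T with
  | leaf v => simp [eval]
  | node j t₀ t₁ ih₀ ih₁ =>
    simp only [vars, Finset.mem_insert, Finset.mem_union, not_or] at h
    obtain ⟨hij, h₀, h₁⟩ := h
    have hj : update x i c j = x j := update_of_ne (fun e => hij e.symm) _ _
    simp only [eval, hj, ih₀ h₀, ih₁ h₁]

/-- The hybrid of a subtree not containing `i` does not read coordinate `i` of `x`. [folklore] -/
theorem hybrid_update_left {T : DTree n} {i : Fin n} (h : i ∉ T.vars) (x y : Cube n) (c : Bool) :
    T.hybrid (update x i c) y = T.hybrid x y := by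
  induction T generalizing y with
  | leaf v => simp [hybrid]
  | node j t₀ t₁ ih₀ ih₁ =>
    simp only [vars, Finset.mem_insert, Finset.mem_union, not_or] at h
    obtain ⟨hij, h₀, h₁⟩ := h
    have hj : update x i c j = x j := update_of_ne (fun e => hij e.symm) _ _
    simp only [hybrid, hj, ih₀ h₀, ih₁ h₁]

end DTree

/-- Discrete derivative in direction `i`; `E|D_i g|` is OSSS's `ρ₁`-influence `Inf_i^{ρ₁}[g]/2`… up to
the factor conventions spelled out in `osss_cov`. [folklore] -/
noncomputable def deriv (i : Fin n) (g : Cube n → ℝ) (x : Cube n) : ℝ :=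
  (g (update x i true) - g (update x i false)) / 2

/-- The coordinate-swap involution on pairs of inputs preserves double sums. [folklore] -/
theorem sum_sum_swap (i : Fin n) (Φ : Cube n → Cube n → ℝ) :
    ∑ x, ∑ y, Φ x y = ∑ x, ∑ y, Φ (update x i (y i)) (update y i (x i)) := by
  let σ : Cube n × Cube n → Cube n × Cube n :=
    fun p => (update p.1 i (p.2 i), update p.2 i (p.1 i))
  have hσ : Function.Involutive σ := by
    intro p
    obtain ⟨x, y⟩ := p
    simp only [σ, update_self, update_idem, update_eq_self]
  calc ∑ x, ∑ y, Φ x y = ∑ p : Cube n × Cube n, Φ p.1 p.2 := (Fintype.sum_prod_type' _).symm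
    _ = ∑ p : Cube n × Cube n, Φ (σ p).1 (σ p).2 := by
        rw [← Equiv.sum_comp (hσ.toPerm σ) (fun p => Φ p.1 p.2)]
        rfl
    _ = ∑ x, ∑ y, Φ (update x i (y i)) (update y i (x i)) :=
        Fintype.sum_prod_type' (fun x y => Φ (update x i (y i)) (update y i (x i)))

/-- A sum over the cube of a branch on `x i` between two functions not depending on `x i` is the
average of their sums. [folklore] -/
theorem sum_ite_eq_half (i : Fin n) (ψ₁ ψ₀ : Cube n → ℝ)
    (h₁ : ∀ x c, ψ₁ (update x i c) = ψ₁ x) (h₀ : ∀ x c, ψ₀ (update x i c) = ψ₀ x) :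
    ∑ x, (if x i = true then ψ₁ x else ψ₀ x) = ((∑ x, ψ₁ x) + ∑ x, ψ₀ x) / 2 := by
  let τ : Cube n → Cube n := fun x => update x i (!x i)
  have hτ : Function.Involutive τ := by
    intro x
    simp only [τ, update_self, update_idem, Bool.not_not, update_eq_self]
  have key : ∑ x, (if x i = true then ψ₁ x else ψ₀ x) = ∑ x, (if x i = true then ψ₀ x else ψ₁ x) := by
    rw [← Equiv.sum_comp (hτ.toPerm τ) (fun x => if x i = true then ψ₀ x else ψ₁ x)]
    refine Finset.sum_congr rfl fun x _ => ?_
    simp only [Function.Involutive.coe_toPerm]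
    rcases Bool.eq_false_or_eq_true (x i) with hx | hx
    · simp [τ, hx, h₁]
    · simp [τ, hx, h₀]
  have hsum : (∑ x, (if x i = true then ψ₁ x else ψ₀ x)) + ∑ x, (if x i = true then ψ₀ x else ψ₁ x)
      = (∑ x, ψ₁ x) + ∑ x, ψ₀ x := by
    rw [← Finset.sum_add_distrib, ← Finset.sum_add_distrib]
    exact Finset.sum_congr rfl fun x _ => by split_ifs <;> ring
  rw [← key] at hsum
  linarith

/-- `|g y − g(y^{i→1})| + |g y − g(y^{i→0})| = 2|D_i g (y)|`. [folklore] -/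
theorem abs_sub_update_add (i : Fin n) (g : Cube n → ℝ) (y : Cube n) :
    |g y - g (update y i true)| + |g y - g (update y i false)| = 2 * |deriv i g y| := by
  rcases Bool.eq_false_or_eq_true (y i) with hy | hy
  · have hu : update y i true = y := by rw [← hy]; exact update_eq_self i y
    rw [hu, sub_self, abs_zero, zero_add, deriv, hu, abs_div, abs_two]
    ring
  · have hu : update y i false = y := by rw [← hy]; exact update_eq_self i y
    rw [hu, sub_self, abs_zero, add_zero, deriv, hu, abs_div, abs_two, abs_sub_comm]
    ring

/-- First hybrid step: `∑_{x,y} |g y − g(y^{i→x_i})| = 2ⁿ · ∑_y |D_i g (y)|`. [folklore] -/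
theorem sum_sum_abs_sub_update (i : Fin n) (g : Cube n → ℝ) :
    ∑ x : Cube n, ∑ y : Cube n, |g y - g (update y i (x i))|
      = (Fintype.card (Cube n) : ℝ) * ∑ y, |deriv i g y| := by
  rw [Finset.sum_comm, Finset.mul_sum]
  refine Finset.sum_congr rfl fun y _ => ?_
  have h1 : ∑ x : Cube n, |g y - g (update y i (x i))|
      = ∑ x : Cube n, (if x i = true then |g y - g (update y i true)| else |g y - g (update y i false)|) := by
    refine Finset.sum_congr rfl fun x _ => ?_
    rcases Bool.eq_false_or_eq_true (x i) with hx | hx <;> simp [hx]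
  rw [h1, sum_ite_eq_half i _ _ (fun _ _ => rfl) (fun _ _ => rfl), Finset.sum_const, Finset.sum_const,
    Finset.card_univ, nsmul_eq_mul, nsmul_eq_mul, ← mul_add, abs_sub_update_add]
  ring

namespace DTree

/-- THE HYBRID BOUND: `∑_{x,y} |g y − g(T.hybrid x y)| ≤ 2ⁿ ∑_j δ_j(T) ∑_z |D_j g (z)|`, i.e.
`E_{x,y}|g(y) − g(hybrid)| ≤ ∑_j δ_j(T)·E|D_j g|` — the chain of inequalities (8)–(10) of the OSSS
proof, in inductive form. [cite: OdonnellEtAl2005, proof of Thm 3.1 pp. 7–8] -/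
theorem hybrid_bound (T : DTree n) (hT : T.Reduced) (g : Cube n → ℝ) :
    ∑ x, ∑ y, |g y - g (T.hybrid x y)|
      ≤ (Fintype.card (Cube n) : ℝ) * ∑ j, T.qprob j * ∑ z, |deriv j g z| := by
  induction T with
  | leaf v => simp [hybrid, qprob]
  | node i t₀ t₁ ih₀ ih₁ =>
    simp only [Reduced] at hT
    obtain ⟨hi₀, hi₁, hr₀, hr₁⟩ := hT
    have IH₀ := ih₀ hr₀
    have IH₁ := ih₁ hr₁
    -- pointwise triangle inequality through the first hybrid `y^{i→x_i}`
    have step : ∀ x y, |g y - g ((node i t₀ t₁).hybrid x y)| ≤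
        |g y - g (update y i (x i))| +
        (if y i = true then |g (update y i (x i)) - g (t₁.hybrid x (update y i (x i)))|
          else |g (update y i (x i)) - g (t₀.hybrid x (update y i (x i)))|) := by
      intro x y
      simp only [hybrid]
      split_ifs with h
      · exact abs_sub_le _ _ _
      · exact abs_sub_le _ _ _
    -- the swap involution turns the branch on `y i` into a branch on the independent bit `x i`
    have swap : ∑ x, ∑ y, (if x i = true then |g y - g (t₁.hybrid x y)| else |g y - g (t₀.hybrid x y)|)
        = ∑ x, ∑ y, (if y i = true then |g (update y i (x i)) - g (t₁.hybrid x (update y i (x i)))|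
          else |g (update y i (x i)) - g (t₀.hybrid x (update y i (x i)))|) := by
      refine (sum_sum_swap i (fun x y =>
        if x i = true then |g y - g (t₁.hybrid x y)| else |g y - g (t₀.hybrid x y)|)).trans ?_
      refine Finset.sum_congr rfl fun x _ => Finset.sum_congr rfl fun y _ => ?_
      simp only [update_self, hybrid_update_left hi₁, hybrid_update_left hi₀]
    -- independence of `x i`: the branch averages the two subtrees
    have half : ∑ x, ∑ y, (if x i = true then |g y - g (t₁.hybrid x y)| else |g y - g (t₀.hybrid x y)|)
        = ((∑ x, ∑ y, |g y - g (t₁.hybrid x y)|) + ∑ x, ∑ y, |g y - g (t₀.hybrid x y)|) / 2 := by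
      have hpull : ∀ x : Cube n,
          (∑ y, if x i = true then |g y - g (t₁.hybrid x y)| else |g y - g (t₀.hybrid x y)|)
            = if x i = true then ∑ y, |g y - g (t₁.hybrid x y)| else ∑ y, |g y - g (t₀.hybrid x y)| := by
        intro x; split_ifs <;> rfl
      rw [Finset.sum_congr rfl (fun x _ => hpull x)]
      exact sum_ite_eq_half i _ _ (fun x c => by simp only [hybrid_update_left hi₁])
        (fun x c => by simp only [hybrid_update_left hi₀])
    -- bookkeeping of the weights
    have alg : ∑ j, (node i t₀ t₁).qprob j * ∑ z, |deriv j g z|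
        = (∑ z, |deriv i g z|) + ((∑ j, t₁.qprob j * ∑ z, |deriv j g z|)
          + ∑ j, t₀.qprob j * ∑ z, |deriv j g z|) / 2 := by
      have h1 : ∑ j, (node i t₀ t₁).qprob j * ∑ z, |deriv j g z|
          = ∑ j, ((if j = i then ∑ z, |deriv j g z| else 0)
            + (t₀.qprob j * ∑ z, |deriv j g z| + t₁.qprob j * ∑ z, |deriv j g z|) / 2) := by
        refine Finset.sum_congr rfl fun j _ => ?_
        simp only [qprob]
        split_ifs <;> ring
      rw [h1, Finset.sum_add_distrib, Finset.sum_ite_eq' Finset.univ i, if_pos (Finset.mem_univ _),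
        ← Finset.sum_div, Finset.sum_add_distrib]
      ring
    calc ∑ x, ∑ y, |g y - g ((node i t₀ t₁).hybrid x y)|
        ≤ ∑ x, ∑ y, (|g y - g (update y i (x i))| +
            (if y i = true then |g (update y i (x i)) - g (t₁.hybrid x (update y i (x i)))|
              else |g (update y i (x i)) - g (t₀.hybrid x (update y i (x i)))|)) :=
          Finset.sum_le_sum fun x _ => Finset.sum_le_sum fun y _ => step x y
      _ = (Fintype.card (Cube n) : ℝ) * ∑ y, |deriv i g y|
          + ((∑ x, ∑ y, |g y - g (t₁.hybrid x y)|) + ∑ x, ∑ y, |g y - g (t₀.hybrid x y)|) / 2 := by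
          simp only [Finset.sum_add_distrib]
          rw [sum_sum_abs_sub_update i g, ← swap, half]
      _ ≤ (Fintype.card (Cube n) : ℝ) * ∑ y, |deriv i g y|
          + ((Fintype.card (Cube n) : ℝ) * ∑ j, t₁.qprob j * ∑ z, |deriv j g z|
            + (Fintype.card (Cube n) : ℝ) * ∑ j, t₀.qprob j * ∑ z, |deriv j g z|) / 2 := by
          linarith [IH₀, IH₁]
      _ = (Fintype.card (Cube n) : ℝ) * ∑ j, (node i t₀ t₁).qprob j * ∑ z, |deriv j g z| := by
          rw [alg]
          ring

/-- THE LEAF STEP: `∑_{x,y} T.eval y · g(T.hybrid x y) = (∑_y T.eval y)(∑_z g z)`, i.e.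
`E[f(y) g(hybrid)] = E f · E g` — the full hybrid is uniform and independent of the leaf
(OSSS: "`f(x) = f(u[0])` and `u[s] = y`"). [cite: OdonnellEtAl2005, §3.3 p. 8] -/
theorem sum_eval_mul_hybrid (T : DTree n) (hT : T.Reduced) (g : Cube n → ℝ) :
    ∑ x, ∑ y, T.eval y * g (T.hybrid x y) = (∑ y, T.eval y) * ∑ z, g z := by
  induction T with
  | leaf v =>
    simp only [eval, hybrid, Finset.sum_const, Finset.card_univ, nsmul_eq_mul, ← Finset.mul_sum]
    ring
  | node i t₀ t₁ ih₀ ih₁ =>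
    simp only [Reduced] at hT
    obtain ⟨hi₀, hi₁, hr₀, hr₁⟩ := hT
    have IH₀ := ih₀ hr₀
    have IH₁ := ih₁ hr₁
    -- rewrite the summand as a branch on `y i` of functions of the first hybrid
    have hsum : ∀ x y, (node i t₀ t₁).eval y * g ((node i t₀ t₁).hybrid x y)
        = if y i = true then t₁.eval (update y i (x i)) * g (t₁.hybrid x (update y i (x i)))
          else t₀.eval (update y i (x i)) * g (t₀.hybrid x (update y i (x i))) := by
      intro x y
      simp only [eval, hybrid, eval_update_of_not_mem hi₁, eval_update_of_not_mem hi₀]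
      split_ifs <;> rfl
    have swap : ∑ x, ∑ y, (if x i = true then t₁.eval y * g (t₁.hybrid x y) else t₀.eval y * g (t₀.hybrid x y))
        = ∑ x, ∑ y, (if y i = true then t₁.eval (update y i (x i)) * g (t₁.hybrid x (update y i (x i)))
          else t₀.eval (update y i (x i)) * g (t₀.hybrid x (update y i (x i)))) := by
      refine (sum_sum_swap i (fun x y =>
        if x i = true then t₁.eval y * g (t₁.hybrid x y) else t₀.eval y * g (t₀.hybrid x y))).trans ?_
      refine Finset.sum_congr rfl fun x _ => Finset.sum_congr rfl fun y _ => ?_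
      simp only [update_self, hybrid_update_left hi₁, hybrid_update_left hi₀]
    have half : ∑ x, ∑ y, (if x i = true then t₁.eval y * g (t₁.hybrid x y) else t₀.eval y * g (t₀.hybrid x y))
        = ((∑ x, ∑ y, t₁.eval y * g (t₁.hybrid x y)) + ∑ x, ∑ y, t₀.eval y * g (t₀.hybrid x y)) / 2 := by
      have hpull : ∀ x : Cube n,
          (∑ y, if x i = true then t₁.eval y * g (t₁.hybrid x y) else t₀.eval y * g (t₀.hybrid x y))
            = if x i = true then ∑ y, t₁.eval y * g (t₁.hybrid x y)
              else ∑ y, t₀.eval y * g (t₀.hybrid x y) := by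
        intro x; split_ifs <;> rfl
      rw [Finset.sum_congr rfl (fun x _ => hpull x)]
      exact sum_ite_eq_half i _ _ (fun x c => by simp only [hybrid_update_left hi₁])
        (fun x c => by simp only [hybrid_update_left hi₀])
    have hf : ∑ y, (node i t₀ t₁).eval y = ((∑ y, t₁.eval y) + ∑ y, t₀.eval y) / 2 := by
      simp only [eval]
      exact sum_ite_eq_half i _ _ (fun y c => eval_update_of_not_mem hi₁ y c)
        (fun y c => eval_update_of_not_mem hi₀ y c)
    calc ∑ x, ∑ y, (node i t₀ t₁).eval y * g ((node i t₀ t₁).hybrid x y)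
        = ∑ x, ∑ y, (if y i = true then t₁.eval (update y i (x i)) * g (t₁.hybrid x (update y i (x i)))
          else t₀.eval (update y i (x i)) * g (t₀.hybrid x (update y i (x i)))) :=
          Finset.sum_congr rfl fun x _ => Finset.sum_congr rfl fun y _ => hsum x y
      _ = ((∑ y, t₁.eval y) * ∑ z, g z + (∑ y, t₀.eval y) * ∑ z, g z) / 2 := by
          rw [← swap, half, IH₁, IH₀]
      _ = (∑ y, (node i t₀ t₁).eval y) * ∑ z, g z := by rw [hf]; ring

/-- THE TWO-FUNCTION OSSS INEQUALITY (sum form):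
`2ⁿ ∑_y f y · g y − (∑ f)(∑ g) ≤ 2ⁿ ∑_j δ_j(T) ∑_z |D_j g (z)|` for `f = T.eval` with `|f| ≤ 1`,
i.e. `Cov[f, g] ≤ ∑_j δ_j(T) · E|D_j g|` — the "alternate version" of OSSS Theorem 3.2 for
`f : Ω → [−1,1]` computed by `T` and `g : Ω → ℝ` (their `Inf_i^{ρ₁}[g] = E|g(x) − g(x^{(i)})|` with the
`i`-th coordinate re-randomised equals `E|D_i g|` here). [cite: OdonnellEtAl2005, §3.3 Thm 3.2 and eq. (alternate version) p. 8] -/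
theorem osss_cov (T : DTree n) (hT : T.Reduced) (hb : ∀ y, |T.eval y| ≤ 1) (g : Cube n → ℝ) :
    (Fintype.card (Cube n) : ℝ) * ∑ y, T.eval y * g y - (∑ y, T.eval y) * ∑ y, g y
      ≤ (Fintype.card (Cube n) : ℝ) * ∑ j, T.qprob j * ∑ z, |deriv j g z| := by
  rw [← sum_eval_mul_hybrid T hT g]
  have h1 : (Fintype.card (Cube n) : ℝ) * ∑ y, T.eval y * g y = ∑ _x : Cube n, ∑ y, T.eval y * g y := by
    rw [Finset.sum_const, Finset.card_univ, nsmul_eq_mul]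
  rw [h1, ← Finset.sum_sub_distrib]
  calc ∑ x, ((∑ y, T.eval y * g y) - ∑ y, T.eval y * g (T.hybrid x y))
      = ∑ x, ∑ y, T.eval y * (g y - g (T.hybrid x y)) := by
        refine Finset.sum_congr rfl fun x _ => ?_
        rw [← Finset.sum_sub_distrib]
        exact Finset.sum_congr rfl fun y _ => by ring
    _ ≤ ∑ x, ∑ y, |g y - g (T.hybrid x y)| := by
        refine Finset.sum_le_sum fun x _ => Finset.sum_le_sum fun y _ => ?_
        calc T.eval y * (g y - g (T.hybrid x y)) ≤ |T.eval y * (g y - g (T.hybrid x y))| := le_abs_self _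
          _ = |T.eval y| * |g y - g (T.hybrid x y)| := abs_mul _ _
          _ ≤ 1 * |g y - g (T.hybrid x y)| := mul_le_mul_of_nonneg_right (hb y) (abs_nonneg _)
          _ = |g y - g (T.hybrid x y)| := one_mul _
    _ ≤ _ := hybrid_bound T hT g

/-- THE TWO-FUNCTION OSSS INEQUALITY (expectation form with the depth):
if `E|D_j g| ≤ M` for every `j` (and `0 ≤ M`), then `Cov[T.eval, g] ≤ depth(T) · M`; with
`Cov[f,g] ≥ Var g − 2E|f − g|`-type lower bounds this is OSSS's query lower bound for APPROXIMATING `g`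
(p. 8, display after Thm 3.2). [cite: OdonnellEtAl2005, §3.3 p. 8] -/
theorem osss_cov_depth (T : DTree n) (hT : T.Reduced) (hb : ∀ y, |T.eval y| ≤ 1) (g : Cube n → ℝ)
    {M : ℝ} (hM0 : 0 ≤ M) (hM : ∀ j, ∑ z, |deriv j g z| ≤ (Fintype.card (Cube n) : ℝ) * M) :
    (∑ y, T.eval y * g y) / (Fintype.card (Cube n) : ℝ)
      - ((∑ y, T.eval y) / (Fintype.card (Cube n) : ℝ)) * ((∑ y, g y) / (Fintype.card (Cube n) : ℝ))
      ≤ (T.depth : ℝ) * M := by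
  have hN : 0 < (Fintype.card (Cube n) : ℝ) := by exact_mod_cast Fintype.card_pos
  have key := osss_cov T hT hb g
  have hq : ∑ j, T.qprob j * ∑ z, |deriv j g z| ≤ (Fintype.card (Cube n) : ℝ) * M * T.depth := by
    calc ∑ j, T.qprob j * ∑ z, |deriv j g z| ≤ ∑ j, T.qprob j * ((Fintype.card (Cube n) : ℝ) * M) :=
          Finset.sum_le_sum fun j _ => mul_le_mul_of_nonneg_left (hM j) (qprob_nonneg T j)
      _ = ((Fintype.card (Cube n) : ℝ) * M) * ∑ j, T.qprob j := by rw [← Finset.sum_mul]; ring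
      _ ≤ ((Fintype.card (Cube n) : ℝ) * M) * T.depth :=
          mul_le_mul_of_nonneg_left (sum_qprob_le_depth T) (by positivity)
  have hrw : (∑ y, T.eval y * g y) / (Fintype.card (Cube n) : ℝ)
      - ((∑ y, T.eval y) / (Fintype.card (Cube n) : ℝ)) * ((∑ y, g y) / (Fintype.card (Cube n) : ℝ))
      = ((Fintype.card (Cube n) : ℝ) * ∑ y, T.eval y * g y - (∑ y, T.eval y) * ∑ y, g y)
        / (Fintype.card (Cube n) : ℝ) ^ 2 := by
    field_simp
  rw [hrw, div_le_iff₀ (by positivity)]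
  calc (Fintype.card (Cube n) : ℝ) * ∑ y, T.eval y * g y - (∑ y, T.eval y) * ∑ y, g y
      ≤ (Fintype.card (Cube n) : ℝ) * ∑ j, T.qprob j * ∑ z, |deriv j g z| := key
    _ ≤ (Fintype.card (Cube n) : ℝ) * ((Fintype.card (Cube n) : ℝ) * M * T.depth) :=
        mul_le_mul_of_nonneg_left hq hN.le
    _ = (T.depth : ℝ) * M * (Fintype.card (Cube n) : ℝ) ^ 2 := by ring

end DTree

end Literature.Probability.ODonnellSaksSchrammServedio2005
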